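import Mathlib
import HarnessLib

/-!
# Oscillation and covariance of link-Lipschitz cylinder functions of a lattice gauge field

For a function `f` of a gauge configuration `U : E → G` (any index type `E` of links) reading only the links of a finite
set `Λ` and Lipschitz in every single link with constant `K_f` for the Frobenius distance through a unitary matrix
representation `ρ : G →* M_N(ℂ)` (the metric currency of Dobrushin / Helffer–Sjöstrand-type clustering estimates for
lattice gauge theories, Shen–Zhu–Zhu 2023 §4; tree `IsLipschitzCylinder` is the sup-metric variant):

* `sqrt_sum_norm_sub_le_of_unitary` — two unitaries are at Frobenius distance `≤ 2N`;
* `abs_sub_le_of_linkLipschitz` — oscillation `|f U − f V| ≤ K_f · |Λ| · 2N` (change the links of `Λ` one at a time);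
* `abs_cov_le_of_linkLipschitz` — under ANY probability measure, `|∫ f g − ∫ f ∫ g| ≤ 2 (2N K_f |Λ_f|)(2N K_g |Λ_g|)`.

Filed from crux stmt-QuantumFields-8761 (line `Sketch`): the `k = 0` end of its Lipschitz-currency clustering heart.
References: H. Shen, R. Zhu, X. Zhu, CMP 400 (2023), §4 (Lipschitz observables of lattice Yang–Mills); folklore.
Deliberately NOT here: any decay in the separation (that is the mass-gap content).
-/

noncomputable section

open scoped BigOperators
open _root_.MeasureTheory

namespace Literature.MathematicalPhysics.QuantumLattice

variable {G : Type} [Group G] {N : ℕ} {E : Type} [DecidableEq E]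

/-- Frobenius size of a difference of two unitary matrices: `√(∑ |(u − v)_{ab}|²) ≤ 2N` (every entry of a
unitary has modulus `≤ 1`, so every entry of the difference has modulus `≤ 2`, and there are `N²` entries).
[folklore] -/
theorem sqrt_sum_norm_sub_le_of_unitary {u v : Matrix (Fin N) (Fin N) ℂ}
    (hu : u ∈ Matrix.unitaryGroup (Fin N) ℂ) (hv : v ∈ Matrix.unitaryGroup (Fin N) ℂ) :
    Real.sqrt (∑ a, ∑ b, ‖(u - v) a b‖ ^ 2) ≤ 2 * N := by
  have hent : ∀ a b, ‖(u - v) a b‖ ≤ 2 := fun a b => by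
    have h1 := entry_norm_bound_of_unitary hu a b
    have h2 := entry_norm_bound_of_unitary hv a b
    rw [Matrix.sub_apply]
    exact (norm_sub_le _ _).trans (by linarith)
  have hsum : ∑ a, ∑ b, ‖(u - v) a b‖ ^ 2 ≤ (2 * N) ^ 2 := by
    calc ∑ a, ∑ b, ‖(u - v) a b‖ ^ 2 ≤ ∑ a : Fin N, ∑ b : Fin N, (2 : ℝ) ^ 2 :=
          Finset.sum_le_sum fun a _ => Finset.sum_le_sum fun b _ =>
            pow_le_pow_left₀ (norm_nonneg _) (hent a b) 2
      _ = (2 * N) ^ 2 := by simp [Finset.sum_const, Finset.card_univ]; ring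
  calc Real.sqrt (∑ a, ∑ b, ‖(u - v) a b‖ ^ 2) ≤ Real.sqrt ((2 * N) ^ 2) := Real.sqrt_le_sqrt hsum
    _ = 2 * N := Real.sqrt_sq (by positivity)

/-- **Oscillation of a link-Lipschitz cylinder function.**  If `f : (E → G) → ℝ` reads only the links of the
finite set `Λ` and is Lipschitz in every single link with constant `K` for the Frobenius distance through a
unitary representation `ρ` of degree `N`, then `|f U − f V| ≤ K · |Λ| · (2N)` for all `U, V` (induction on
`Λ`, changing one link at a time). [folklore] -/
theorem abs_sub_le_of_linkLipschitz (ρ : G →* Matrix (Fin N) (Fin N) ℂ)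
    (hρ : ∀ g, ρ g ∈ Matrix.unitaryGroup (Fin N) ℂ) {K : ℝ} (hK : 0 ≤ K) (Λ : Finset E)
    (f : (E → G) → ℝ) (hdep : DependsOn f (↑Λ : Set E))
    (hlip : ∀ (U : E → G) (e : E) (h : G),
      |f (Function.update U e h) - f U| ≤ K * Real.sqrt (∑ a, ∑ b, ‖(ρ h - ρ (U e)) a b‖ ^ 2))
    (U V : E → G) : |f U - f V| ≤ K * Λ.card * (2 * N) := by
  induction Λ using Finset.induction_on generalizing f with
  | empty =>
    have : f U = f V := hdep fun e he => by simp at he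
    simp [this]
  | @insert e Λ he ih =>
    -- freeze the link `e` at the value `U e`
    set f' : (E → G) → ℝ := fun X => f (Function.update X e (U e)) with hf'
    have hdep' : DependsOn f' (↑Λ : Set E) := by
      intro X Y hXY
      refine hdep fun e' he' => ?_
      rcases Finset.mem_insert.1 he' with rfl | h'
      · simp
      · by_cases hee : e' = e
        · subst hee; simp
        · simp only [Function.update_of_ne hee]; exact hXY e' h'
    have hlip' : ∀ (X : E → G) (e' : E) (h : G),
        |f' (Function.update X e' h) - f' X| ≤ K * Real.sqrt (∑ a, ∑ b, ‖(ρ h - ρ (X e')) a b‖ ^ 2) := by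
      intro X e' h
      by_cases hee : e' = e
      · subst hee
        have : f' (Function.update X e' h) = f' X := by
          simp only [hf', Function.update_idem]
        rw [this, sub_self, abs_zero]
        positivity
      · have hcomm : Function.update (Function.update X e' h) e (U e) =
            Function.update (Function.update X e (U e)) e' h := Function.update_comm hee _ _ _
        simp only [hf']
        rw [hcomm]
        have h1 := hlip (Function.update X e (U e)) e' h
        rwa [Function.update_of_ne hee] at h1
    have hU : f U = f' U := by simp [hf']
    have hW : f' V = f (Function.update V e (U e)) := rfl
    have step1 : |f' U - f' V| ≤ K * Λ.card * (2 * N) := ih f' hdep' hlip'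
    have step2 : |f (Function.update V e (U e)) - f V| ≤ K * (2 * N) := by
      refine (hlip V e (U e)).trans ?_
      exact mul_le_mul_of_nonneg_left (sqrt_sum_norm_sub_le_of_unitary (hρ _) (hρ _)) hK
    rw [Finset.card_insert_of_notMem he]
    calc |f U - f V| = |(f' U - f' V) + (f (Function.update V e (U e)) - f V)| := by
          rw [hU, hW]; ring_nf
      _ ≤ |f' U - f' V| + |f (Function.update V e (U e)) - f V| := abs_add_le _ _
      _ ≤ K * Λ.card * (2 * N) + K * (2 * N) := add_le_add step1 step2
      _ = K * ((Λ.card + 1 : ℕ) : ℝ) * (2 * N) := by push_cast; ring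

/-- **A priori covariance bound in the Lipschitz currency** (the volume- and
coupling-independent bound every clustering estimate in this currency starts from): under any probability measure on torus gauge configurations, two bounded measurable link-Lipschitz cylinder
functions satisfy `|∫ f g − ∫ f ∫ g| ≤ 2 · (K_f |Λ_f| 2N) · (K_g |Λ_g| 2N)`. [folklore] -/
theorem abs_cov_le_of_linkLipschitz [MeasurableSpace G] (ρ : G →* Matrix (Fin N) (Fin N) ℂ)
    (hρ : ∀ g, ρ g ∈ Matrix.unitaryGroup (Fin N) ℂ) (μ : Measure (E → G)) [IsProbabilityMeasure μ]
    {f g : (E → G) → ℝ} {Λf Λg : Finset E} {Kf Kg : ℝ} (hKf : 0 ≤ Kf) (hKg : 0 ≤ Kg)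
    (hfm : Measurable f) (hgm : Measurable g) (hfb : ∃ M, ∀ U, |f U| ≤ M) (hgb : ∃ M, ∀ U, |g U| ≤ M)
    (hfdep : DependsOn f (↑Λf : Set E)) (hgdep : DependsOn g (↑Λg : Set E))
    (hflip : ∀ (U : E → G) (e : E) (h : G),
      |f (Function.update U e h) - f U| ≤ Kf * Real.sqrt (∑ a, ∑ b, ‖(ρ h - ρ (U e)) a b‖ ^ 2))
    (hglip : ∀ (U : E → G) (e : E) (h : G),
      |g (Function.update U e h) - g U| ≤ Kg * Real.sqrt (∑ a, ∑ b, ‖(ρ h - ρ (U e)) a b‖ ^ 2)) :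
    |(∫ U, f U * g U ∂μ) - (∫ U, f U ∂μ) * ∫ U, g U ∂μ| ≤
      2 * (Kf * Λf.card * (2 * N)) * (Kg * Λg.card * (2 * N)) := by
  rcases isEmpty_or_nonempty (E → G) with hE | ⟨⟨U₀⟩⟩
  · -- no configurations: all integrals vanish
    have h0 : ∀ (F : (E → G) → ℝ), ∫ U, F U ∂μ = 0 := fun F => by
      rw [integral_eq_zero_of_ae (Filter.Eventually.of_forall fun U => (IsEmpty.false U).elim)]
    rw [h0, h0, h0]; norm_num; positivity
  set a : ℝ := Kf * Λf.card * (2 * N) with ha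
  set b : ℝ := Kg * Λg.card * (2 * N) with hb
  have hfa : ∀ U, |f U - f U₀| ≤ a := fun U => abs_sub_le_of_linkLipschitz ρ hρ hKf Λf f hfdep hflip U U₀
  have hgb' : ∀ U, |g U - g U₀| ≤ b := fun U => abs_sub_le_of_linkLipschitz ρ hρ hKg Λg g hgdep hglip U U₀
  obtain ⟨Mf, hMf⟩ := hfb
  obtain ⟨Mg, hMg⟩ := hgb
  have hfi : Integrable f μ := Integrable.of_bound hfm.aestronglyMeasurable Mf
    (ae_of_all _ fun U => by rw [Real.norm_eq_abs]; exact hMf U)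
  have hgi : Integrable g μ := Integrable.of_bound hgm.aestronglyMeasurable Mg
    (ae_of_all _ fun U => by rw [Real.norm_eq_abs]; exact hMg U)
  -- centre both functions at `U₀`
  set f₁ : (E → G) → ℝ := fun U => f U - f U₀ with hf₁
  set g₁ : (E → G) → ℝ := fun U => g U - g U₀ with hg₁
  have hf₁i : Integrable f₁ μ := hfi.sub (integrable_const _)
  have hg₁i : Integrable g₁ μ := hgi.sub (integrable_const _)
  have hf₁g₁i : Integrable (fun U => f₁ U * g₁ U) μ := by
    refine Integrable.of_bound (hf₁i.aestronglyMeasurable.mul hg₁i.aestronglyMeasurable) (a * b)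
      (ae_of_all _ fun U => ?_)
    rw [Real.norm_eq_abs, abs_mul]
    exact mul_le_mul (hfa U) (hgb' U) (abs_nonneg _) ((abs_nonneg _).trans (hfa U))
  have hcov : (∫ U, f U * g U ∂μ) - (∫ U, f U ∂μ) * ∫ U, g U ∂μ =
      (∫ U, f₁ U * g₁ U ∂μ) - (∫ U, f₁ U ∂μ) * ∫ U, g₁ U ∂μ := by
    have e1 : ∫ U, f₁ U ∂μ = (∫ U, f U ∂μ) - f U₀ := by
      simp only [hf₁]; rw [integral_sub hfi (integrable_const _), integral_const, probReal_univ, one_smul]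
    have e2 : ∫ U, g₁ U ∂μ = (∫ U, g U ∂μ) - g U₀ := by
      simp only [hg₁]; rw [integral_sub hgi (integrable_const _), integral_const, probReal_univ, one_smul]
    have e3 : ∫ U, f₁ U * g₁ U ∂μ =
        (∫ U, f U * g U ∂μ) - g U₀ * (∫ U, f U ∂μ) - f U₀ * (∫ U, g U ∂μ) + f U₀ * g U₀ := by
      have hfg : Integrable (fun U => f U * g U) μ := by
        refine Integrable.of_bound (hfm.aestronglyMeasurable.mul hgm.aestronglyMeasurable) (Mf * Mg)
          (ae_of_all _ fun U => ?_)
        rw [Real.norm_eq_abs, abs_mul]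
        exact mul_le_mul (hMf U) (hMg U) (abs_nonneg _) ((abs_nonneg _).trans (hMf U))
      have hexp : (fun U => f₁ U * g₁ U) =
          fun U => f U * g U - g U₀ * f U - f U₀ * g U + f U₀ * g U₀ := by
        funext U; simp only [hf₁, hg₁]; ring
      rw [hexp, integral_add, integral_sub, integral_sub hfg (hfi.const_mul _), integral_const_mul,
        integral_const_mul, integral_const, probReal_univ, one_smul]
      · exact hfg.sub (hfi.const_mul _)
      · exact hgi.const_mul _
      · exact (hfg.sub (hfi.const_mul _)).sub (hgi.const_mul _)
      · exact integrable_const _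
    rw [e1, e2, e3]; ring
  rw [hcov]
  have h1 : |∫ U, f₁ U * g₁ U ∂μ| ≤ a * b := by
    rw [← Real.norm_eq_abs]
    refine (norm_integral_le_of_norm_le_const (C := a * b) (ae_of_all _ fun U => ?_)).trans (by simp)
    rw [Real.norm_eq_abs, abs_mul]
    exact mul_le_mul (hfa U) (hgb' U) (abs_nonneg _) ((abs_nonneg _).trans (hfa U))
  have h2 : |∫ U, f₁ U ∂μ| ≤ a := by
    rw [← Real.norm_eq_abs]
    refine (norm_integral_le_of_norm_le_const (C := a) (ae_of_all _ fun U => ?_)).trans (by simp)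
    rw [Real.norm_eq_abs]; exact hfa U
  have h3 : |∫ U, g₁ U ∂μ| ≤ b := by
    rw [← Real.norm_eq_abs]
    refine (norm_integral_le_of_norm_le_const (C := b) (ae_of_all _ fun U => ?_)).trans (by simp)
    rw [Real.norm_eq_abs]; exact hgb' U
  have ha0 : 0 ≤ a := (abs_nonneg _).trans (hfa U₀)
  calc |(∫ U, f₁ U * g₁ U ∂μ) - (∫ U, f₁ U ∂μ) * ∫ U, g₁ U ∂μ|
      ≤ |∫ U, f₁ U * g₁ U ∂μ| + |(∫ U, f₁ U ∂μ) * ∫ U, g₁ U ∂μ| := abs_sub _ _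
    _ ≤ a * b + a * b := by
        rw [abs_mul]
        exact add_le_add h1 (mul_le_mul h2 h3 (abs_nonneg _) ha0)
    _ = 2 * a * b := by ring

end Literature.MathematicalPhysics.QuantumLattice

end
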